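import Literature.InformationTheory.QuantumCodes.QuantumExpanderNoisySyndrome
import HarnessLib

/-!
# Small-set-flip with a NOISY syndrome (Fawzi–Grospellier–Leverrier, FOCS 2018), part 3: §3.4 — the noisy
# execution support (Prop. 22, component form) and witnesses (Lemma 25) — PROOF

Index of sources: `[cite: FawziGrospellierLeverrier2018FT]` = Fawzi–Grospellier–Leverrier, FOCS 2018 / arXiv:1808.03821, §3.4
"Random errors of linear size" (p0019 L1 – p0021 L9): Lemma 19 (locality, = the STOC paper's Prop. 12), Def. 20 (`α`-subsets),
Lemma 21, Prop. 22 ("`U ∪ D` is a `2α₀`-subset of `E ∪ D`"), Def. 23 (`𝓜(S)`), Def. 24 (`c`-witness: `W ∈ 𝓜(S)` and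
`|W| ≤ c|D ∩ Γ_X(W)|`), Lemma 25 (witnesses inside a reduced small remaining error) and the first half of the proof of
Lemma 26 (p0021 L1-4: the component-wise `α₀`-subset property "`K ∪ (D ∩ Γ_X(K))` is an `α₀`-subset of
`(E ∩ K) ∪ (D ∩ Γ_X(K))`"); `[cite: FawziGrospellierLeverrier2018]` = STOC 2018 / arXiv:1711.08351v2, Lemma 14 and Prop. 12
(the noiseless versions, in the tree as `SmallSetFlip.isAlphaSubset_of_closed_run`, `SmallSetFlip.ssfRun_restrict`).

Topic `Literature/InformationTheory/QuantumCodes` (venture QEC, row 04 `prover-qec-type-04` gen 8, line L-SSF-NOISY = PARTITION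
v2.48 D50.L8, nodes N10–N11 — the deterministic inputs of FGL18b Thm. 13, whose probabilistic assembly is NOT in this file).
Vocabulary as in parts 1–2; `C_K = Γ_X(K)` is written `univ.filter (∃ q ∈ K, Hs c q ≠ 0)`; "`K` closed in `U`" = no check
of `Hs` (resp. no generator of `Hg`) touches both `K` and `U ∖ K` (a union of connected components of `U` in the syndrome
adjacency graph `𝒢`); the tree's decoder rule is `κ|F|` (so the printed `(βd_A/2)|Fᵢ|` is `κ|Fᵢ|`).

* `indicator_flipVec` — `𝟙_D ∩ C_K = 𝟙_{D ∩ C_K}`;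
* `card_closed_le_of_noisy_run` — **Prop. 22 in component form with syndrome noise** (generic syndrome/generator
  matrices): along a complete valid run (threshold `κ > 0`) from `σ_X(E) ⊕ 𝟙_D` with flips inside `U ⊇ E`, `U ⊆ E ∪ ⋃Fᵢ`,
  `|σ_X(v)| ≤ w|v|`, every closed `K ⊆ U` has `κ|K| ≤ (κ + w)|E ∩ K| + |D ∩ C_K|` (so `K ∪ (D ∩ C_K)` is a
  `κ/(κ+w)`-subset of `(E ∩ K) ∪ (D ∩ C_K)` when `w ≥ 1`: `isAlphaSubset_mixed_of_noisy_run`);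
* ★ `fgl18b_lemma25` — **Lemma 25 (core inequality)**: if the observed syndrome `σ_X(E_R) ⊕ D` of a REDUCED remaining
  error `E_R` with `max Δ·|E_R| ≤ min Δ·min(γ_A n_A, γ_B n_B)` passes the halting test of Algorithm 1 (parameter
  `β ∈ [0, β₁)`), then EVERY `W ⊆ E_R` closed in `E_R` for the check-adjacency satisfies `|W| ≤ c₀·|D ∩ Γ_X(W)|`
  (`c₀ = 4/(min Δ(β₁ − β))`) — in particular the printed witness `W` = the components of `E_R` meeting `S`;
  `fgl18b_lemma25_ssfDecoder` — the same at the halting syndrome of any tree small-set-flip decoder (`β = 2κ/min Δ`).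

Column word: PROVED (kernel); no definitions, no named facts. The probabilistic part of §3.4 (Lemma 26 second half, Lemma 27,
Thm. 13) is not here.
-/

namespace Literature.InformationTheory.QuantumCodes

open Finset Matrix

/-! ### Prop. 22 with syndrome noise, component form (generic matrices) -/

namespace SmallSetFlip

variable {Q C R : Type*} [Fintype Q] [Fintype C] [Fintype R] [DecidableEq Q] [DecidableEq C]

omit [Fintype Q] [Fintype C] [Fintype R] [DecidableEq Q] in
/-- Restricting the syndrome-error indicator to a set of checks: `𝟙_D ∩ C_K = 𝟙_{D ∩ C_K}`.
[cite: FawziGrospellierLeverrier2018FT, Lemma 19 (input "(E ∩ K, D ∩ Γ_X(K))"; arXiv p0019 L5-7)] -/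
theorem indicator_flipVec (D CK : Finset C) :
    Set.indicator (CK : Set C) (flipVec D) = flipVec (D ∩ CK) := by
  classical
  ext c
  by_cases hc : c ∈ (CK : Set C)
  · rw [Set.indicator_of_mem hc]
    have hc' : c ∈ CK := by exact_mod_cast hc
    simp [flipVec, Finset.mem_inter, hc']
  · rw [Set.indicator_of_notMem hc]
    have hc' : c ∉ CK := by exact_mod_cast hc
    simp [flipVec, Finset.mem_inter, hc']

omit [DecidableEq Q] [DecidableEq C] [Fintype C] [Fintype R] in
/-- Subadditivity of the Hamming weight. [folklore] -/
private theorem hammingNorm_add_le₄ {ι : Type*} [Fintype ι] (x y : ι → ZMod 2) :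
    hammingNorm (x + y) ≤ hammingNorm x + hammingNorm y := by
  have h := hammingDist_triangle (x + y) y 0
  have h1 : hammingDist (x + y) y = hammingNorm x := by
    rw [hammingDist_comm, hammingDist_eq_hammingNorm]
    congr 1; ext i; simp only [Pi.add_apply, Pi.neg_apply]; ring
  rw [hammingDist_zero_right, hammingDist_zero_right, h1] at h
  exact h

/-- **FGL18b Prop. 22 / first half of the proof of Lemma 26, with syndrome noise, component form** (generic: syndrome
matrix `Hs`, generator matrix `Hg`, tree threshold rule `κ|F|`, column bound `|σ_X(v)| ≤ w|v|`). Along a complete valid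
run from the NOISY syndrome `σ_X(E) ⊕ 𝟙_D` whose flips lie in `U ⊇ E` with `U ⊆ E ∪ ⋃Fᵢ`, every `K ⊆ U` closed in `U`
for the check- and generator-adjacency satisfies `κ|K| ≤ (κ + w)|E ∩ K| + |D ∩ C_K|`: by locality the flips inside `K`
form a valid run from `σ_X(E ∩ K) ⊕ 𝟙_{D ∩ C_K}`, which pays `κ` per flipped qubit out of `≤ w|E ∩ K| + |D ∩ C_K|`
syndrome bits, and `|K| ≤ |E ∩ K| + Σ_{Fᵢ ⊆ K}|Fᵢ|`. (Printed, global form: "`|U ∪ D| ≤ |E ∪ D| + Σ|Fᵢ| ≤ (1/2α₀)|E ∪ D|`";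
component form: "`K ∪ (D ∩ Γ_X(K))` is an `α₀`-subset of `(E ∩ K) ∪ (D ∩ Γ_X(K))`".)
[cite: FawziGrospellierLeverrier2018FT, Prop 22 and its proof (arXiv p0019 L39-52); proof of Lemma 26 (p0021 L1-4)]
[cite: FawziGrospellierLeverrier2018, Lemma 14 (arXiv v2 p0012 L18-33)] -/
theorem card_closed_le_of_noisy_run {Hs : Matrix C Q (ZMod 2)} {Hg : Matrix R Q (ZMod 2)}
    {κ w : ℝ} (hκ : 0 < κ)
    (hw : ∀ v : Q → ZMod 2, (hammingNorm (Hs *ᵥ v) : ℝ) ≤ w * hammingNorm v)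
    {E : Finset Q} {D : Finset C} {l : List (Finset Q)}
    (hrun : IsSSFRun κ Hs Hg (Hs *ᵥ flipVec E + flipVec D) l)
    {U K : Finset Q} (hEU : E ⊆ U) (hKU : K ⊆ U)
    (hKX : ∀ q ∈ K, ∀ q' ∈ U, ∀ c, Hs c q ≠ 0 → Hs c q' ≠ 0 → q' ∈ K)
    (hKZ : ∀ q ∈ K, ∀ q' ∈ U, ∀ g, Hg g q ≠ 0 → Hg g q' ≠ 0 → q' ∈ K)
    (hl : ∀ F ∈ l, F ⊆ U) (hU : ∀ q ∈ U, q ∈ E ∨ ∃ F ∈ l, q ∈ F) :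
    κ * (K.card : ℝ) ≤ (κ + w) * ((E ∩ K).card : ℝ)
      + ((D ∩ univ.filter fun c => ∃ q ∈ K, Hs c q ≠ 0).card : ℝ) := by
  classical
  set CK : Finset C := univ.filter fun c => ∃ q ∈ K, Hs c q ≠ 0 with hCK
  obtain ⟨hrunK, -⟩ := ssfRun_restrict U K hKX hKZ hrun hl
  rw [Set.indicator_add', indicator_mulVec_flipVec_eq Hs U K E hKX hEU, indicator_flipVec] at hrunK
  obtain ⟨-, hinv⟩ := QuantumExpander.ssfRun_invariants hrunK
  have hσ : (hammingNorm (Hs *ᵥ flipVec (E ∩ K) + flipVec (D ∩ CK)) : ℝ)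
      ≤ w * ((E ∩ K).card : ℝ) + (D ∩ CK).card := by
    have h1 := hammingNorm_add_le₄ (Hs *ᵥ flipVec (E ∩ K)) (flipVec (D ∩ CK))
    rw [QuantumExpander.hammingNorm_flipVec] at h1
    have h2 := hw (flipVec (E ∩ K))
    rw [QuantumExpander.hammingNorm_flipVec] at h2
    have h1' : (hammingNorm (Hs *ᵥ flipVec (E ∩ K) + flipVec (D ∩ CK)) : ℝ)
        ≤ hammingNorm (Hs *ᵥ flipVec (E ∩ K)) + (D ∩ CK).card := by exact_mod_cast h1
    linarith
  have hsum : κ * (((l.filter fun F => decide (F ⊆ K)).map Finset.card).sum : ℝ)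
      ≤ w * (E ∩ K).card + (D ∩ CK).card := by
    have h0 : (0 : ℝ) ≤ hammingNorm (Hs *ᵥ flipVec (E ∩ K) + flipVec (D ∩ CK)
        + Hs *ᵥ runOutput (l.filter fun F => decide (F ⊆ K))) := Nat.cast_nonneg _
    linarith
  have hcard : (K.card : ℝ)
      ≤ (E ∩ K).card + (((l.filter fun F => decide (F ⊆ K)).map Finset.card).sum : ℝ) := by
    have h := card_le_of_closed_run (mem_smallSets_of_isSSFRun hrun) (E := E) hKU hKZ hl hU
    exact_mod_cast h
  have h1 : κ * (K.card : ℝ)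
      ≤ κ * (E ∩ K).card + κ * (((l.filter fun F => decide (F ⊆ K)).map Finset.card).sum : ℝ) := by
    rw [← mul_add]; exact mul_le_mul_of_nonneg_left hcard hκ.le
  rw [inter_comm D] at hsum ⊢
  nlinarith [hsum, h1]

/-- The **mixed `α`-subset form** (FGL18b's wording, counting qubits and checks together): under the hypotheses of
`card_closed_le_of_noisy_run` and `w ≥ 1`, `κ(|K| + |D ∩ C_K|) ≤ (κ + w)(|E ∩ K| + |D ∩ C_K|)`, i.e. `K ∪ (D ∩ C_K)` is a
`κ/(κ+w)`-subset of `(E ∩ K) ∪ (D ∩ C_K)` in the syndrome adjacency graph on `V ⊔ C_X`.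
[cite: FawziGrospellierLeverrier2018FT, proof of Lemma 26 ("K ∪ (D ∩ Γ_X(K)) is an α₀-subset of (E ∩ K) ∪ (D ∩ Γ_X(K))"; arXiv p0021 L2-4)] -/
theorem isAlphaSubset_mixed_of_noisy_run {Hs : Matrix C Q (ZMod 2)} {Hg : Matrix R Q (ZMod 2)}
    {κ w : ℝ} (hκ : 0 < κ) (hw1 : 1 ≤ w)
    (hw : ∀ v : Q → ZMod 2, (hammingNorm (Hs *ᵥ v) : ℝ) ≤ w * hammingNorm v)
    {E : Finset Q} {D : Finset C} {l : List (Finset Q)}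
    (hrun : IsSSFRun κ Hs Hg (Hs *ᵥ flipVec E + flipVec D) l)
    {U K : Finset Q} (hEU : E ⊆ U) (hKU : K ⊆ U)
    (hKX : ∀ q ∈ K, ∀ q' ∈ U, ∀ c, Hs c q ≠ 0 → Hs c q' ≠ 0 → q' ∈ K)
    (hKZ : ∀ q ∈ K, ∀ q' ∈ U, ∀ g, Hg g q ≠ 0 → Hg g q' ≠ 0 → q' ∈ K)
    (hl : ∀ F ∈ l, F ⊆ U) (hU : ∀ q ∈ U, q ∈ E ∨ ∃ F ∈ l, q ∈ F) :
    κ * ((K.card : ℝ) + (D ∩ univ.filter fun c => ∃ q ∈ K, Hs c q ≠ 0).card)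
      ≤ (κ + w) * (((E ∩ K).card : ℝ) + (D ∩ univ.filter fun c => ∃ q ∈ K, Hs c q ≠ 0).card) := by
  have h := card_closed_le_of_noisy_run hκ hw hrun hEU hKU hKX hKZ hl hU
  have h0 : (0 : ℝ) ≤ ((D ∩ univ.filter fun c => ∃ q ∈ K, Hs c q ≠ 0).card : ℝ) := Nat.cast_nonneg _
  nlinarith

end SmallSetFlip

/-! ### Lemma 25: witnesses inside a reduced small remaining error -/

namespace QuantumExpander

variable {A B : Type*} [Fintype A] [Fintype B] [DecidableEq A] [DecidableEq B]

/-- A `0/1`-vector is the indicator of its support. [folklore] -/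
private theorem flipVec_supp' (x : (A × A) ⊕ (B × B) → ZMod 2) : flipVec (supp x) = x := by
  classical
  funext q
  have h01 : ∀ z : ZMod 2, z = 0 ∨ z = 1 := by decide
  rcases h01 (x q) with h | h <;> simp [flipVec, supp, h]

/-- ★ **FGL18b Lemma 25 (core inequality).** Let `G` be `(Δ_A, Δ_B)`-biregular (`Δ ≥ 1`) and `(γ_A, δ_A, γ_B, δ_B)`-expanding,
`δ = max(δ_A, δ_B) ≥ 0`, `β ∈ [0, β₁)`, `c₀ = 4/(min Δ·(β₁ − β))`. Let `E_R` be a REDUCED remaining error with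
`max Δ·|E_R| ≤ min Δ·min(γ_A n_A, γ_B n_B)` whose observed syndrome `σ_X(E_R) ⊕ D` passes the halting test of Algorithm 1.
Then every `W ⊆ E_R` closed in `E_R` for the check-adjacency ("no `X`-check touches both `W` and `E_R ∖ W`"; e.g. the
printed `W` = all connected components of `E_R` in `𝒢` that meet a given `S ⊆ E_R`, which is then a `c₀`-witness for
`(S, D)`) satisfies `|W| ≤ c₀·|D ∩ Γ_X(W)|`. Proof as printed: by locality the restricted syndrome
`(σ_X(E_R) ⊕ D) ∩ Γ_X(W) = σ_X(W) ⊕ (D ∩ Γ_X(W))` still passes the halting test (restriction only lowers decreases,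
Lemma 21); `W` is reduced as a subset of `E_R` (Lemma 17) and not larger; Cor. 16 gives
`|W| ≤ c₀|D ∩ Γ_X(W) ∩ σ_X(W)| ≤ c₀|D ∩ Γ_X(W)|`.
[cite: FawziGrospellierLeverrier2018FT, Lemma 25 and its proof (arXiv p0020 L22-39); Def 24 (c-witness)] -/
theorem fgl18b_lemma25 (H : Matrix B A (ZMod 2)) {dA dB : ℕ} {γA δA γB δB : ℝ}
    (hreg : IsBiregular H dA dB) (hexp : IsLeftRightExpanding H dA dB γA δA γB δB)
    (hdA : 0 < dA) (hdB : 0 < dB) (hδA : 0 ≤ δA) (hδB : 0 ≤ δB)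
    {β : ℝ} (hβ0 : 0 ≤ β) (hβ1 : β < 1 - 16 * max δA δB)
    (eR : (A × A) ⊕ (B × B) → ZMod 2) (D : Finset (A × B))
    (hhalt : ∀ F ∈ smallSets (expanderHZ H),
      ((min dA dB : ℕ) : ℝ) / 2 * F.card ≤ hammingNorm (expanderHX H *ᵥ flipVec F) →
      ¬ (β * hammingNorm (expanderHX H *ᵥ flipVec F)
          ≤ syndromeDecrease (expanderHX H) (expanderHX H *ᵥ eR + flipVec D) F))
    (hred : ∀ u ∈ rowSpace (expanderHZ H), hammingNorm eR ≤ hammingNorm (eR + u))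
    (hw : ((max dA dB : ℕ) : ℝ) * hammingNorm eR
      ≤ ((min dA dB : ℕ) : ℝ) * min (γA * Fintype.card A) (γB * Fintype.card B))
    (W : Finset ((A × A) ⊕ (B × B))) (hWsub : W ⊆ supp eR)
    (hWX : ∀ q ∈ W, ∀ q' ∈ supp eR, ∀ c, expanderHX H c q ≠ 0 → expanderHX H c q' ≠ 0 → q' ∈ W) :
    (W.card : ℝ) ≤ 4 / (((min dA dB : ℕ) : ℝ) * (1 - 16 * max δA δB - β))
        * ((D ∩ univ.filter fun c => ∃ q ∈ W, expanderHX H c q ≠ 0).card : ℝ) := by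
  classical
  set CW : Finset (A × B) := univ.filter fun c => ∃ q ∈ W, expanderHX H c q ≠ 0 with hCW
  have hδ0 : 0 ≤ max δA δB := le_max_of_le_left hδA
  have hc0 : 0 ≤ 4 / (((min dA dB : ℕ) : ℝ) * (1 - 16 * max δA δB - β)) := by
    apply div_nonneg (by norm_num)
    have : (0 : ℝ) < ((min dA dB : ℕ) : ℝ) := by exact_mod_cast lt_min hdA hdB
    nlinarith
  -- the restricted syndrome is `σ_X(W) ⊕ 𝟙_{D ∩ C_W}`
  have hres : Set.indicator (CW : Set (A × B)) (expanderHX H *ᵥ eR + flipVec D)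
      = expanderHX H *ᵥ flipVec W + flipVec (D ∩ CW) := by
    rw [Set.indicator_add', SmallSetFlip.indicator_flipVec]
    congr 1
    have h := SmallSetFlip.indicator_mulVec_flipVec_eq (expanderHX H) (supp eR) W (supp eR) hWX subset_rfl
    rw [flipVec_supp', Finset.inter_eq_right.2 hWsub] at h
    exact h
  -- it passes the halting test (restriction only lowers decreases)
  have hhaltW : ∀ F ∈ smallSets (expanderHZ H),
      ((min dA dB : ℕ) : ℝ) / 2 * F.card ≤ hammingNorm (expanderHX H *ᵥ flipVec F) →
      ¬ (β * hammingNorm (expanderHX H *ᵥ flipVec F)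
          ≤ syndromeDecrease (expanderHX H) (expanderHX H *ᵥ (flipVec W + 0) + flipVec (D ∩ CW)) F) := by
    intro F hF hcal hdec
    rw [add_zero, ← hres] at hdec
    have hle := SmallSetFlip.syndromeDecrease_indicator_le (expanderHX H) (expanderHX H *ᵥ eR + flipVec D) CW F
    have hleR : (syndromeDecrease (expanderHX H)
        (Set.indicator (CW : Set (A × B)) (expanderHX H *ᵥ eR + flipVec D)) F : ℝ)
        ≤ syndromeDecrease (expanderHX H) (expanderHX H *ᵥ eR + flipVec D) F := by exact_mod_cast hle
    exact hhalt F hF hcal (hdec.trans hleR)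
  -- `W` is reduced (Lemma 17) and small
  have hsuppW : supp (flipVec W + 0) = W := by rw [add_zero, supp_flipVec]
  have hredW : ∀ u ∈ rowSpace (expanderHZ H), hammingNorm (flipVec W + 0) ≤ hammingNorm (flipVec W + 0 + u) := by
    intro u hu
    exact hammingNorm_le_hammingNorm_add_of_subset (by rw [hsuppW]; exact hWsub) (hred u hu)
  have hWcard : hammingNorm (flipVec W + 0) = W.card := by rw [add_zero, hammingNorm_flipVec]
  have hWle : W.card ≤ hammingNorm eR := by
    have := Finset.card_le_card hWsub
    simpa [supp, hammingNorm] using this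
  have hwW : ((max dA dB : ℕ) : ℝ) * hammingNorm (flipVec W + 0)
      ≤ ((min dA dB : ℕ) : ℝ) * min (γA * Fintype.card A) (γB * Fintype.card B) := by
    rw [hWcard]
    refine le_trans ?_ hw
    exact mul_le_mul_of_nonneg_left (by exact_mod_cast hWle) (Nat.cast_nonneg _)
  -- Cor. 16 for the pair `(W, 0)` and the syndrome error `D ∩ C_W`
  have h16 := fgl18b_corollary16 H hreg hexp hdA hdB hδA hδB hβ0 hβ1 (flipVec W) 0 (D ∩ CW) hhaltW hredW hwW
  rw [hWcard] at h16
  refine h16.trans (mul_le_mul_of_nonneg_left ?_ hc0)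
  exact_mod_cast Finset.card_le_card
    ((Finset.inter_subset_left).trans Finset.inter_subset_right |> fun h => Finset.subset_inter
      ((Finset.inter_subset_left).trans Finset.inter_subset_left) h)

/-- **Lemma 25 at the halting syndrome of a tree small-set-flip decoder.** For `Dec` a small-set-flip decoder of the
tree (`IsSSFDecoder κ`, `0 < κ`, `2κ < min Δ·β₁`) run on the noisy syndrome `σ_X(E) ⊕ 𝟙_D`, if the remaining error
`E_R = E ⊕ Ê` is reduced with `max Δ·|E_R| ≤ min Δ·min(γ_A n_A, γ_B n_B)`, then every `W ⊆ E_R` closed in `E_R` for the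
check-adjacency satisfies `|W| ≤ 4|D ∩ Γ_X(W)|/(min Δ·β₁ − 2κ)` (Lemma 25 with `β = 2κ/min Δ`).
[cite: FawziGrospellierLeverrier2018FT, Lemma 25 (arXiv p0020 L22-39)] -/
theorem fgl18b_lemma25_ssfDecoder (H : Matrix B A (ZMod 2)) {dA dB : ℕ} {γA δA γB δB : ℝ}
    (hreg : IsBiregular H dA dB) (hexp : IsLeftRightExpanding H dA dB γA δA γB δB)
    (hdA : 0 < dA) (hdB : 0 < dB) (hδA : 0 ≤ δA) (hδB : 0 ≤ δB)
    {κ : ℝ} (hκ0 : 0 < κ) (hκ1 : 2 * κ < ((min dA dB : ℕ) : ℝ) * (1 - 16 * max δA δB))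
    (Dec : Decoder (A × B → ZMod 2) ((A × A) ⊕ (B × B) → ZMod 2))
    (hDec : IsSSFDecoder κ (expanderHX H) (expanderHZ H) Dec)
    (e : (A × A) ⊕ (B × B) → ZMod 2) (D : Finset (A × B)) {Ehat : (A × A) ⊕ (B × B) → ZMod 2}
    (hout : Dec (expanderHX H *ᵥ e + flipVec D) = Ehat)
    (hred : ∀ u ∈ rowSpace (expanderHZ H), hammingNorm (e + Ehat) ≤ hammingNorm (e + Ehat + u))
    (hw : ((max dA dB : ℕ) : ℝ) * hammingNorm (e + Ehat)
      ≤ ((min dA dB : ℕ) : ℝ) * min (γA * Fintype.card A) (γB * Fintype.card B))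
    (W : Finset ((A × A) ⊕ (B × B))) (hWsub : W ⊆ supp (e + Ehat))
    (hWX : ∀ q ∈ W, ∀ q' ∈ supp (e + Ehat), ∀ c, expanderHX H c q ≠ 0 → expanderHX H c q' ≠ 0 → q' ∈ W) :
    (W.card : ℝ) ≤ 4 / (((min dA dB : ℕ) : ℝ) * (1 - 16 * max δA δB) - 2 * κ)
        * ((D ∩ univ.filter fun c => ∃ q ∈ W, expanderHX H c q ≠ 0).card : ℝ) := by
  classical
  have hdm' : (0 : ℝ) < ((min dA dB : ℕ) : ℝ) := by exact_mod_cast lt_min hdA hdB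
  set β : ℝ := 2 * κ / ((min dA dB : ℕ) : ℝ) with hβdef
  have hβ0 : 0 ≤ β := by positivity
  have hβ1 : β < 1 - 16 * max δA δB := by
    rw [hβdef, div_lt_iff₀ hdm']; linarith
  obtain ⟨l, hrun, hl⟩ := hDec (expanderHX H *ᵥ e + flipVec D)
  have hhalts := (ssfRun_invariants hrun).1
  have hfin : expanderHX H *ᵥ e + flipVec D + expanderHX H *ᵥ runOutput l
      = expanderHX H *ᵥ (e + Ehat) + flipVec D := by
    rw [← hout, hl, Matrix.mulVec_add]; abel
  rw [hfin] at hhalts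
  have hhalt := haltingTest_of_ssfHalts H hdA hdB hκ0 hhalts
  have h25 := fgl18b_lemma25 H hreg hexp hdA hdB hδA hδB hβ0 hβ1 (e + Ehat) D hhalt hred hw W hWsub hWX
  have hden : ((min dA dB : ℕ) : ℝ) * (1 - 16 * max δA δB - β)
      = ((min dA dB : ℕ) : ℝ) * (1 - 16 * max δA δB) - 2 * κ := by
    rw [hβdef]; field_simp
  rw [hden] at h25
  exact h25

end QuantumExpander

end Literature.InformationTheory.QuantumCodes
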